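import Literature.Computability.Complexity.CookBridges
import Summits.PneNP.PneNP.Theses.SzkEntropy

/-!
# Route SzkEntropy — support item `CookModelBridge` (stmt-PneNP-10679)

The model bridge used by the deciding theorem `closes` of route `SzkEntropy`:
Cook's Clay-problem classes over `{0,1}` (`PNPWave0.P Bool`, `PNPWave0.NP Bool`, in which the
summit statement `PneNP` is phrased) coincide with the tree's working classes
`Classes.P = ⋃ₖ DTIME(nᵏ)` and `Nondeterministic.NP = polyExists P`
[Cook, Clay problem description §1; Arora–Barak 2009, Def. 1.13 and Def. 2.1].

Both equalities are PROVED Literature theorems. We take them from the conjecture-free module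
`Literature/Computability/Complexity/CookBridges.lean` (`p_bool_eq`, `CookBridges.np_bool_eq`)
rather than from `ClayProblem.lean` / `ClayProblemProofs.lean` (`P_bool_eq_holds`,
`NP_bool_eq_holds`, same statements), so that this file's import cone contains no open named
conjecture (`ClayProblem.lean` declares `NPNotSubsetPPoly`) — the same design reason for which the
planner filed the bridge as an item instead of invoking it inside `closes`.

Nothing else is here: the target `PeaThreeNotInP`, `PeaMemPH`, `PhCollapse` and the assembly are
separate items of the route.
-/

namespace Summit.PneNP.PneNP.Theorems

/-- **`CookModelBridge` holds** (route `SzkEntropy`, item stmt-PneNP-10679):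
`PNPWave0.P Bool = Classes.P ∧ PNPWave0.NP Bool = Nondeterministic.NP`, the pair of the proved
model bridges `Literature.Computability.Complexity.p_bool_eq` and
`Literature.Computability.Complexity.CookBridges.np_bool_eq`
[Cook, Clay problem description §1; Arora–Barak 2009, Def. 1.13, Def. 2.1, Claim 1.5]. -/
theorem cookModelBridge_proof : Summit.PneNP.PneNP.Theses.SzkEntropy.CookModelBridge :=
  ⟨Literature.Computability.Complexity.p_bool_eq,
    Literature.Computability.Complexity.CookBridges.np_bool_eq⟩

end Summit.PneNP.PneNP.Theorems
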